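import Mathlib
import HarnessLib
import Summits.HubbardSuperconductivity.HubbardSuperconductivity.Theorems.KLProgrammeKLRegimeTwoVolumeTowerBaseTransfer
import Literature.MathematicalPhysics.QuantumLattice.HubbardSectorGridOverlapReindex

/-!
# Route `KLProgramme` — crux K3, VL child `KLRegimeVolumeLimitV17F2` (stmt-HubbardSuperconductivity-20440), base of the two-volume tower:
# THE ROWS OF THE PLAIN SOURCE BLOCK `klSrcPlainBlock·S_{4M}` GROW LIKE `ln M` — NEGATIVE KNOWLEDGE for base atom (i), source half
# (located defect «BASE-SRC-ROWS»; cell gate-hubbard-kl, seat p3 g18; `--supports` 20440)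

The base-transfer bundle `hdataT` of the VL interface of record (`…TwoVolumeTowerDataTSExists.exists_towerDataTS_of_readouts`), through
`…TwoVolumeTowerBaseTransferData.towerBase_transferData_of_atoms` (hypotheses `hBrow/hBcol`), asks for ONE constant `cgW` bounding the
`(1 + Λ_T·|Δx⃗|)`-weighted rows and columns of the plain source block `klSrcPlainBlock V M β · hubbardGridSub V M β (4M)` for ALL large `M`.
No such constant exists.  The block reads the copy-`1` (source) grid legs back at the `2M` lattice points through the full-band multiplier
`trivialMultiplier ≡ 1`, i.e. it is `ε·E_1·S_{4M}`, and `E_1·S_{4M}` is the band projection from the `4M`-point time grid to the `2M`-point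
lattice: at the grid-time difference `d = q₀ − 2x₀ ∈ ℤ/4M` its entry is `β⁻¹·|Σ_{j<2M} e^{2πi·jd/4M}|·[q⃗ = x⃗]`, a Dirichlet-type kernel which is
`2M/β` at `d = 0`, `0` at even `d ≠ 0` and `1/(β|sin(πd/4M)|)` at odd `d`.  Hence (this file, everything PROVED):

* §1 `torusChar_natCast_one`, `charSum_halfRange_eq_geom`, `norm_charSum_halfRange_zero`, **`norm_geom_halfRange_ge`** — the half-range character
  sum is a geometric sum; at `d = 0` its norm is `2M`; at odd `0 < v < 4M` its norm is `≥ 4M/(π v)` (from `(Σ x^j)(x − 1) = x^{2M} − 1 = −2` and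
  `‖e^{iθ} − 1‖ ≤ |θ|`);
* §2 **`srcBlock_row_eq`** — the EXACT row: `Σ_y ‖(klSrcPlainBlock·S_{4M}) (x, ((ω,σ),0)) y‖ = (1/2M)·Σ_{d ∈ ℤ/4M} ‖Σ_{j<2M} χ_j(d)‖` (`ω` the slot-`0`
  sector, any `x`, `σ`, any `β ≠ 0`, any volume);
* §3 **`srcBlock_row_ge_harmonic`** — `≥ 1 + (2/π)·Σ_{i<2M} 1/(2i+1)`; **`srcBlock_row_ge_log`** — `≥ 1 + log(2M+1)/π`;
* §4 **`not_exists_uniform_srcBlock_rowBound`** — for every volume `V`, every `β ≠ 0` and every rate `Λ_T ≥ 0` there is NO `C` with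
  `Σ_y ‖(klSrcPlainBlock V M β·S_{4M}) Y y‖·(1 + Λ_T·tnorm(x⃗_Y − x⃗_y)) ≤ C` for all `M` and all rows `Y`: the hypothesis `hBrow` of
  `towerBase_transferData_of_atoms` (hence conjunct 1 of `hdataT`) has no `M`-uniform witness.

What this does NOT say: nothing here refutes `stub_vl_towerData`, the VL child, K3 or any registered statement — the plain source block is the cauchy
line's own device (grid-leg doubling `klDoubleOne` read at lattice points), and the ALIVE block is `M`-uniform (`…TowerBaseAliveBlockRows`).  It says
that the base (H6) must be re-keyed (smooth band multiplier on slot-`0` source legs, or an `ℓ²`/merged treatment of `E_1·S`).  Proofs only; no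
definition; no sorry.  [cite: BenfattoGiulianiMastropietro2006, §2.7 (2.70)–(2.71a); Salmhofer1999, §4.2.4 (4.55)–(4.63)]
-/

noncomputable section

namespace Summit.HubbardSuperconductivity.HubbardSuperconductivity.Theorems.TwoVolumeSource

set_option linter.dupNamespace false -- summit = problem name (single-conjunct summit), D-0017

open Finset Complex Literature.MathematicalPhysics.QuantumLattice GrassmannAlgebra Literature.Probability.LatticeModels
open Summit.HubbardSuperconductivity.HubbardSuperconductivity.Theorems.KLProgrammeLegKernels
open Summit.HubbardSuperconductivity.HubbardSuperconductivity.Theorems.KLRegimeSplit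
open Summit.HubbardSuperconductivity.HubbardSuperconductivity.Theorems.EngineV8
open Summit.HubbardSuperconductivity.HubbardSuperconductivity.Theorems.TwoVolumeDefect
open scoped ComplexConjugate Real

/-! ## §1 The half-range character sum on `ℤ/4M` -/

/-- The character of the Matsubara index `j` at the grid-time difference `v`: `χ_j(v) = exp(2πi·v/N)^j`. [folklore] -/
theorem torusChar_natCast_one (N : ℕ) [NeZero N] (j v : ℕ) :
    torusChar (fun _ : Fin 1 => ((j : ℕ) : ZMod N)) (fun _ : Fin 1 => ((v : ℕ) : ZMod N)) = Complex.exp (2 * π * I * v / N) ^ j := by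
  rw [torusChar, Fin.prod_univ_one, ← Nat.cast_mul, ZMod.stdAddChar_apply, ZMod.toCircle_natCast, ← Complex.exp_nat_mul]
  congr 1
  push_cast
  ring

/-- The half-range character sum at a natural representative is a geometric sum. [folklore] -/
theorem charSum_halfRange_eq_geom (M : ℕ) [NeZero M] (v : ℕ) :
    haveI : NeZero (2 * (2 * M)) := ⟨by have := NeZero.ne M; omega⟩
    ∑ j : Fin (2 * M), torusChar (fun _ : Fin 1 => ((j : ℕ) : ZMod (2 * (2 * M)))) (fun _ : Fin 1 => ((v : ℕ) : ZMod (2 * (2 * M)))) =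
      ∑ j ∈ Finset.range (2 * M), Complex.exp (2 * π * I * v / (2 * (2 * M) : ℕ)) ^ j := by
  haveI : NeZero (2 * (2 * M)) := ⟨by have := NeZero.ne M; omega⟩
  simp_rw [torusChar_natCast_one]
  exact Fin.sum_univ_eq_sum_range (fun j => Complex.exp (2 * π * I * v / (2 * (2 * M) : ℕ)) ^ j) (2 * M)

/-- At the zero difference the half-range sum has norm `2M`. [folklore] -/
theorem norm_charSum_halfRange_zero (M : ℕ) [NeZero M] :
    haveI : NeZero (2 * (2 * M)) := ⟨by have := NeZero.ne M; omega⟩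
    ‖∑ j : Fin (2 * M), torusChar (fun _ : Fin 1 => ((j : ℕ) : ZMod (2 * (2 * M)))) (0 : TorusSite 1 (2 * (2 * M)))‖ = 2 * M := by
  haveI : NeZero (2 * (2 * M)) := ⟨by have := NeZero.ne M; omega⟩
  simp only [torusChar_zero_right, sum_const, card_univ, Fintype.card_fin, nsmul_eq_mul, mul_one]
  rw [Complex.norm_natCast]
  push_cast
  ring

/-- **The half-range geometric sum at an ODD difference is large**: for odd `v < 4M`, `‖Σ_{j<2M} x^j‖ ≥ 4M/(π v)` with `x = exp(2πi·v/4M)`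
(`(Σ x^j)(x − 1) = x^{2M} − 1 = (−1)^v − 1 = −2` and `‖x − 1‖ = 2|sin(πv/4M)| ≤ 2πv/4M`). [folklore] -/
theorem norm_geom_halfRange_ge (M : ℕ) [NeZero M] {v : ℕ} (hv : Odd v) :
    (2 * (2 * M) : ℕ) / (π * v) ≤ ‖∑ j ∈ Finset.range (2 * M), Complex.exp (2 * π * I * v / (2 * (2 * M) : ℕ)) ^ j‖ := by
  have hM0 : (0 : ℝ) < M := Nat.cast_pos.2 (Nat.pos_of_ne_zero (NeZero.ne M))
  have hv0 : (0 : ℝ) < v := Nat.cast_pos.2 hv.pos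
  set x : ℂ := Complex.exp (2 * π * I * v / (2 * (2 * M) : ℕ)) with hx
  set S : ℂ := ∑ j ∈ Finset.range (2 * M), x ^ j with hS
  -- `S·(x − 1) = x^{2M} − 1 = −2`
  have hpow : x ^ (2 * M) = -1 := by
    rw [hx, ← Complex.exp_nat_mul]
    have h : ((2 * M : ℕ) : ℂ) * (2 * π * I * v / (2 * (2 * M) : ℕ)) = (v : ℕ) * (π * I) := by
      have hM' : (M : ℂ) ≠ 0 := by exact_mod_cast (NeZero.ne M)
      push_cast
      field_simp
    rw [h, Complex.exp_nat_mul, Complex.exp_pi_mul_I, hv.neg_one_pow]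
  have hgeom : S * (x - 1) = -2 := by
    rw [hS, geom_sum_mul, hpow]
    norm_num
  -- `‖x − 1‖ ≤ 2πv/N`
  have hθ : x = Complex.exp (I * ((2 * π * v / (2 * (2 * M) : ℕ) : ℝ) : ℂ)) := by
    rw [hx]
    congr 1
    push_cast
    ring
  have hx1 : ‖x - 1‖ ≤ 2 * π * v / (2 * (2 * M) : ℕ) := by
    rw [hθ]
    refine (Real.norm_exp_I_mul_ofReal_sub_one_le).trans (le_of_eq ?_)
    rw [Real.norm_eq_abs, abs_of_nonneg (by positivity)]
  -- `‖S‖·(2πv/N) ≥ ‖S‖·‖x − 1‖ = 2`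
  have hN0 : (0 : ℝ) < ((2 * (2 * M) : ℕ) : ℝ) := Nat.cast_pos.2 (by have := NeZero.ne M; omega)
  have h2 : (2 : ℝ) ≤ ‖S‖ * (2 * π * v) / (2 * (2 * M) : ℕ) := by
    have h := congr_arg (fun z : ℂ => ‖z‖) hgeom
    simp only [norm_mul, norm_neg] at h
    rw [show ‖(2 : ℂ)‖ = 2 by norm_num] at h
    calc (2 : ℝ) = ‖S‖ * ‖x - 1‖ := h.symm
      _ ≤ ‖S‖ * (2 * π * v / (2 * (2 * M) : ℕ)) := mul_le_mul_of_nonneg_left hx1 (norm_nonneg _)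
      _ = ‖S‖ * (2 * π * v) / (2 * (2 * M) : ℕ) := by ring
  rw [le_div_iff₀ hN0] at h2
  rw [div_le_iff₀ (by positivity)]
  have hid : ‖S‖ * (2 * π * v) = 2 * (‖S‖ * (π * v)) := by ring
  linarith

/-- **The half-range character sums over the whole time torus are large**: `Σ_{d ∈ ℤ/4M} ‖Σ_{j<2M} χ_j(d)‖ ≥ 2M + Σ_{i<2M} 4M/(π(2i+1))`
(the zero difference and the `2M` odd differences `d = 2i+1`). [folklore] -/
theorem sum_norm_charSum_halfRange_ge (M : ℕ) [NeZero M] :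
    haveI : NeZero (2 * (2 * M)) := ⟨by have := NeZero.ne M; omega⟩
    2 * (M : ℝ) + ∑ i ∈ Finset.range (2 * M), ((2 * (2 * M) : ℕ) : ℝ) / (π * ((2 * i + 1 : ℕ) : ℝ)) ≤
      ∑ d : TorusSite 1 (2 * (2 * M)), ‖∑ j : Fin (2 * M), torusChar (fun _ : Fin 1 => ((j : ℕ) : ZMod (2 * (2 * M)))) d‖ := by
  classical
  haveI : NeZero (2 * (2 * M)) := ⟨by have := NeZero.ne M; omega⟩
  set N : ℕ := 2 * (2 * M) with hN
  set h : ZMod N → ℝ := fun a => ‖∑ j : Fin (2 * M), torusChar (fun _ : Fin 1 => ((j : ℕ) : ZMod N)) (fun _ : Fin 1 => a)‖ with hh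
  -- the sum over `TorusSite 1 N = Fin 1 → ZMod N` is the sum over `ZMod N`
  have hequiv : ∑ d : TorusSite 1 N, ‖∑ j : Fin (2 * M), torusChar (fun _ : Fin 1 => ((j : ℕ) : ZMod N)) d‖ = ∑ a : ZMod N, h a := by
    refine Fintype.sum_equiv (Equiv.funUnique (Fin 1) (ZMod N)) _ _ fun d => ?_
    have hd : (fun _ : Fin 1 => d default) = d := by
      funext i
      rw [Fin.eq_zero i]
      rfl
    simp only [hh, Equiv.funUnique_apply, hd]
  rw [hequiv]
  -- the odd representatives `2i+1`, `i < 2M`, and `0`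
  set c : Fin (2 * M) → ZMod N := fun i => ((2 * (i : ℕ) + 1 : ℕ) : ZMod N) with hc
  have hcval : ∀ i : Fin (2 * M), (c i).val = 2 * (i : ℕ) + 1 := fun i => by
    rw [hc, ZMod.val_natCast, Nat.mod_eq_of_lt (by rw [hN]; have := i.isLt; omega)]
  have hc_inj : Function.Injective c := fun i i' hii => by
    have hv := congr_arg ZMod.val hii
    rw [hcval, hcval] at hv
    exact Fin.ext (by omega)
  have h0notin : (0 : ZMod N) ∉ (univ : Finset (Fin (2 * M))).image c := by
    simp only [mem_image, mem_univ, true_and, not_exists]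
    intro i hi
    have hv := congr_arg ZMod.val hi
    rw [hcval, ZMod.val_zero] at hv
    omega
  -- the values: `h 0 = 2M`, `h (c i) ≥ N/(π(2i+1))`
  have hzero : h 0 = 2 * M := by
    simp only [hh]
    exact norm_charSum_halfRange_zero M
  have hodd : ∀ i : Fin (2 * M), ((N : ℕ) : ℝ) / (π * ((2 * (i : ℕ) + 1 : ℕ) : ℝ)) ≤ h (c i) := fun i => by
    simp only [hh, hc]
    rw [charSum_halfRange_eq_geom M (2 * (i : ℕ) + 1)]
    exact norm_geom_halfRange_ge M (odd_two_mul_add_one (i : ℕ))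
  calc 2 * (M : ℝ) + ∑ i ∈ Finset.range (2 * M), ((N : ℕ) : ℝ) / (π * ((2 * i + 1 : ℕ) : ℝ))
      = h 0 + ∑ i : Fin (2 * M), ((N : ℕ) : ℝ) / (π * ((2 * (i : ℕ) + 1 : ℕ) : ℝ)) := by
        rw [hzero, Fin.sum_univ_eq_sum_range (fun i => ((N : ℕ) : ℝ) / (π * ((2 * i + 1 : ℕ) : ℝ))) (2 * M)]
    _ ≤ h 0 + ∑ i : Fin (2 * M), h (c i) := by
        have := Finset.sum_le_sum fun i (_ : i ∈ (univ : Finset (Fin (2 * M)))) => hodd i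
        linarith
    _ = ∑ a ∈ insert (0 : ZMod N) ((univ : Finset (Fin (2 * M))).image c), h a := by
        rw [sum_insert h0notin, sum_image fun i _ i' _ hii => hc_inj hii]
    _ ≤ ∑ a : ZMod N, h a := sum_le_sum_of_subset_of_nonneg (subset_univ _) fun _ _ _ => norm_nonneg _

/-! ## §2 The exact row of the plain source block -/

section Row

variable {V M : ℕ} [NeZero V] [NeZero M]

omit [NeZero M] in
/-- The plain source overlap `E_1·S_{4M}` vanishes off the legs `((q, σ), c)` of the row's own spin and charge. [folklore] -/
theorem srcOverlap_apply_eq_zero (β : ℝ) (x : SpaceTimeIdx V M) (σ c : Fin 2) (y : GridLeg (GridPoint V (klGridN M))) (h : y.1.2 ≠ σ ∨ y.2 ≠ c) :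
    (sectorAnalysisMatrix V M β (trivialMultiplier V M) * hubbardGridSub V M β (klGridN M)) (x, (((0 : Fin 1), σ), c)) y = 0 := by
  rw [sectorAnalysis_mul_hubbardGridSub_apply, if_neg]
  rintro ⟨h2, h3⟩
  rcases h with h | h
  · exact h h2
  · exact h h3

/-- **The product-torus sum of the trivial multiplier**: `Σ_{(d,w)} ‖Σ_k 1·χ_{k₀}(d)χ_{k⃗}(w)‖ = V²·Σ_d ‖Σ_{j<2M} χ_j(d)‖` (the momentum characters
sum to `V²·[w = 0]`). [folklore] -/
theorem torusSum_trivialMultiplier_eq :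
    ∑ dw : TorusSite 1 (2 * (2 * M)) × TorusSite 2 V, ‖∑ k : FreqMomentum V M, trivialMultiplier V M 0 k *
        (if (0 : Fin 2) = 0 then torusChar (fun _ : Fin 1 => ((k.1 : ℕ) : ZMod (2 * (2 * M)))) dw.1 * torusChar k.2 dw.2
          else conj (torusChar (fun _ : Fin 1 => ((k.1 : ℕ) : ZMod (2 * (2 * M)))) dw.1 * torusChar k.2 dw.2))‖ =
      (V : ℝ) ^ 2 * ∑ d : TorusSite 1 (2 * (2 * M)), ‖∑ j : Fin (2 * M), torusChar (fun _ : Fin 1 => ((j : ℕ) : ZMod (2 * (2 * M)))) d‖ := by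
  classical
  haveI : NeZero (2 * (2 * M)) := ⟨by have := NeZero.ne M; omega⟩
  simp only [trivialMultiplier, one_mul, ↓reduceIte]
  have hfact : ∀ dw : TorusSite 1 (2 * (2 * M)) × TorusSite 2 V,
      ∑ k : FreqMomentum V M, torusChar (fun _ : Fin 1 => ((k.1 : ℕ) : ZMod (2 * (2 * M)))) dw.1 * torusChar k.2 dw.2 =
        (∑ j : Fin (2 * M), torusChar (fun _ : Fin 1 => ((j : ℕ) : ZMod (2 * (2 * M)))) dw.1) * ∑ kv : TorusSite 2 V, torusChar kv dw.2 := by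
    intro dw
    rw [Fintype.sum_prod_type, Finset.sum_mul_sum]
  simp_rw [hfact, sum_torusChar_left]
  rw [Fintype.sum_prod_type, Finset.mul_sum]
  refine Finset.sum_congr rfl fun d _ => ?_
  rw [Fintype.sum_eq_single (0 : TorusSite 2 V) fun w hw => by rw [if_neg hw, mul_zero, norm_zero]]
  rw [if_pos rfl, norm_mul, norm_pow, Complex.norm_natCast, mul_comm]

/-- **THE EXACT ROW OF THE PLAIN SOURCE BLOCK**: for the slot-`0` sector `ω`, every point `x`, spin `σ` (charge `0`), every `β ≠ 0` and every volume,
`Σ_y ‖(klSrcPlainBlock V M β·S_{4M}) (x, ((ω,σ),0)) y‖ = (1/2M)·Σ_{d ∈ ℤ/4M} ‖Σ_{j<2M} χ_j(d)‖`. [cite: BenfattoGiulianiMastropietro2006, §2.7 (2.71a)] -/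
theorem srcBlock_row_eq {β : ℝ} (hβ : β ≠ 0) (x : SpaceTimeIdx V M) (ω : Fin (sectorCount 0)) (hω : (ω : ℕ) = 0) (σ : Fin 2) :
    ∑ y : GridLeg (GridPoint V (klGridN M)), ‖(klSrcPlainBlock V M β * hubbardGridSub V M β (klGridN M)) (x, ((ω, σ), 0)) y‖ =
      1 / (2 * (M : ℝ)) * ∑ d : TorusSite 1 (2 * (2 * M)), ‖∑ j : Fin (2 * M), torusChar (fun _ : Fin 1 => ((j : ℕ) : ZMod (2 * (2 * M)))) d‖ := by
  classical
  haveI : NeZero (2 * (2 * M)) := ⟨by have := NeZero.ne M; omega⟩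
  have hM0 : (0 : ℝ) < M := Nat.cast_pos.2 (Nat.pos_of_ne_zero (NeZero.ne M))
  have hV0 : (0 : ℝ) < V := Nat.cast_pos.2 (Nat.pos_of_ne_zero (NeZero.ne V))
  -- the entries: `|ε|·‖(E_1 S) …‖`
  have hentry : ∀ y : GridLeg (GridPoint V (klGridN M)), ‖(klSrcPlainBlock V M β * hubbardGridSub V M β (klGridN M)) (x, ((ω, σ), 0)) y‖ =
      |imagTimeWeight β M| * ‖(sectorAnalysisMatrix V M β (trivialMultiplier V M) * hubbardGridSub V M β (klGridN M)) (x, (((0 : Fin 1), σ), 0)) y‖ := by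
    intro y
    simp only [klSrcPlainBlock_mul_apply, hω, ↓reduceIte, norm_mul, Complex.norm_real, Real.norm_eq_abs]
  simp_rw [hentry]
  rw [← Finset.mul_sum]
  -- only the legs `((q, σ), 0)` contribute
  have hred : ∑ y : GridLeg (GridPoint V (klGridN M)),
      ‖(sectorAnalysisMatrix V M β (trivialMultiplier V M) * hubbardGridSub V M β (klGridN M)) (x, (((0 : Fin 1), σ), 0)) y‖ =
      ∑ q : GridPoint V (2 * (2 * M)),
        ‖(sectorAnalysisMatrix V M β (trivialMultiplier V M) * hubbardGridSub V M β (2 * (2 * M))) (x, (((0 : Fin 1), σ), 0)) ((q, σ), 0)‖ := by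
    rw [Fintype.sum_prod_type, Fintype.sum_prod_type]
    refine Finset.sum_congr rfl fun q _ => ?_
    rw [Fintype.sum_eq_single σ fun σ' hσ' => ?_, Fintype.sum_eq_single (0 : Fin 2) fun c hc => ?_]
    · rw [srcOverlap_apply_eq_zero β x σ 0 ((q, σ), c) (Or.inr hc), norm_zero]
    · exact Finset.sum_eq_zero fun c _ => by rw [srcOverlap_apply_eq_zero β x σ 0 ((q, σ'), c) (Or.inl hσ'), norm_zero]
  rw [hred, rowSum_norm_sectorAnalysis_mul_hubbardGridSub_eq hβ (trivialMultiplier V M) x 0 σ 0, torusSum_trivialMultiplier_eq]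
  -- `|ε|·(1/(|β|V²))·V² = 1/2M`
  have hβ' : 0 < |β| := abs_pos.2 hβ
  rw [imagTimeWeight, abs_div, abs_mul, abs_two, Nat.abs_cast]
  field_simp

/-! ## §3 The row is at least `1 + (2/π)·Σ_{i<2M} 1/(2i+1) ≥ 1 + log(2M+1)/π` -/

/-- **THE ROW OF THE PLAIN SOURCE BLOCK IS AT LEAST THE ODD HARMONIC SUM**: `Σ_y ‖(klSrcPlainBlock·S_{4M}) (x, ((ω,σ),0)) y‖ ≥ 1 + (2/π)·Σ_{i<2M} 1/(2i+1)`.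
[cite: BenfattoGiulianiMastropietro2006, §2.7 (2.71a)] -/
theorem srcBlock_row_ge_harmonic {β : ℝ} (hβ : β ≠ 0) (x : SpaceTimeIdx V M) (ω : Fin (sectorCount 0)) (hω : (ω : ℕ) = 0) (σ : Fin 2) :
    1 + 2 / π * ∑ i ∈ Finset.range (2 * M), 1 / ((2 * i + 1 : ℕ) : ℝ) ≤
      ∑ y : GridLeg (GridPoint V (klGridN M)), ‖(klSrcPlainBlock V M β * hubbardGridSub V M β (klGridN M)) (x, ((ω, σ), 0)) y‖ := by
  have hM0 : (0 : ℝ) < M := Nat.cast_pos.2 (Nat.pos_of_ne_zero (NeZero.ne M))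
  rw [srcBlock_row_eq hβ x ω hω σ]
  have h := sum_norm_charSum_halfRange_ge M
  have hid : 1 / (2 * (M : ℝ)) * (2 * (M : ℝ) + ∑ i ∈ Finset.range (2 * M), ((2 * (2 * M) : ℕ) : ℝ) / (π * ((2 * i + 1 : ℕ) : ℝ))) =
      1 + 2 / π * ∑ i ∈ Finset.range (2 * M), 1 / ((2 * i + 1 : ℕ) : ℝ) := by
    rw [mul_add, Finset.mul_sum, Finset.mul_sum]
    congr 1
    · field_simp
    · refine Finset.sum_congr rfl fun i _ => ?_
      have hi : (0 : ℝ) < ((2 * i + 1 : ℕ) : ℝ) := by positivity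
      push_cast
      field_simp
  calc 1 + 2 / π * ∑ i ∈ Finset.range (2 * M), 1 / ((2 * i + 1 : ℕ) : ℝ)
      = 1 / (2 * (M : ℝ)) * (2 * (M : ℝ) + ∑ i ∈ Finset.range (2 * M), ((2 * (2 * M) : ℕ) : ℝ) / (π * ((2 * i + 1 : ℕ) : ℝ))) := hid.symm
    _ ≤ _ := mul_le_mul_of_nonneg_left h (by positivity)

/-- The odd harmonic sum dominates half the harmonic number: `Σ_{i<n} 1/(2i+1) ≥ (1/2)·H_n ≥ (1/2)·log(n+1)`. [folklore] -/
theorem log_le_two_mul_oddHarmonic (n : ℕ) : Real.log ((n : ℝ) + 1) ≤ 2 * ∑ i ∈ Finset.range n, 1 / ((2 * i + 1 : ℕ) : ℝ) := by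
  have h1 : Real.log ((n : ℝ) + 1) ≤ ∑ i ∈ Finset.range n, (((i : ℝ) + 1))⁻¹ := by
    have := log_add_one_le_harmonic n
    rw [harmonic] at this
    push_cast at this
    exact this
  refine h1.trans ?_
  rw [Finset.mul_sum]
  refine Finset.sum_le_sum fun i _ => ?_
  have hi : (0 : ℝ) ≤ i := Nat.cast_nonneg i
  have h3 : (0 : ℝ) < ((2 * i + 1 : ℕ) : ℝ) := by positivity
  rw [inv_eq_one_div, div_le_iff₀ (by positivity)]
  have hid : 2 * (1 / ((2 * i + 1 : ℕ) : ℝ)) * ((i : ℝ) + 1) = (2 * (i : ℝ) + 2) / ((2 * i + 1 : ℕ) : ℝ) := by ring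
  rw [hid, le_div_iff₀ h3]
  push_cast
  linarith

/-- **THE ROW GROWS LIKE `log M`**: `Σ_y ‖(klSrcPlainBlock V M β·S_{4M}) (x, ((ω,σ),0)) y‖ ≥ 1 + log(2M+1)/π`. [cite: BenfattoGiulianiMastropietro2006, §2.7 (2.71a)] -/
theorem srcBlock_row_ge_log {β : ℝ} (hβ : β ≠ 0) (x : SpaceTimeIdx V M) (ω : Fin (sectorCount 0)) (hω : (ω : ℕ) = 0) (σ : Fin 2) :
    1 + Real.log (2 * (M : ℝ) + 1) / π ≤
      ∑ y : GridLeg (GridPoint V (klGridN M)), ‖(klSrcPlainBlock V M β * hubbardGridSub V M β (klGridN M)) (x, ((ω, σ), 0)) y‖ := by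
  refine le_trans ?_ (srcBlock_row_ge_harmonic hβ x ω hω σ)
  have h : Real.log (2 * (M : ℝ) + 1) ≤ 2 * ∑ i ∈ Finset.range (2 * M), 1 / ((2 * i + 1 : ℕ) : ℝ) := by
    have h0 := log_le_two_mul_oddHarmonic (2 * M)
    have e : ((2 * M : ℕ) : ℝ) = 2 * (M : ℝ) := by push_cast; ring
    rw [e] at h0
    exact h0
  have hπ := Real.pi_pos
  rw [add_le_add_iff_left, div_le_iff₀ hπ]
  calc Real.log (2 * (M : ℝ) + 1) ≤ 2 * ∑ i ∈ Finset.range (2 * M), 1 / ((2 * i + 1 : ℕ) : ℝ) := h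
    _ = 2 / π * (∑ i ∈ Finset.range (2 * M), 1 / ((2 * i + 1 : ℕ) : ℝ)) * π := by field_simp

end Row

/-! ## §4 No `M`-uniform row bound for the plain source block -/

/-- **NO `M`-UNIFORM ROW BOUND FOR THE PLAIN SOURCE BLOCK** (negative knowledge for `hBrow` of `towerBase_transferData_of_atoms`, hence for conjunct 1 of
the binder `hdataT` of `exists_towerDataTS_of_readouts`): for every volume `V`, every `β ≠ 0` and every rate `Λ_T ≥ 0` there is no constant `C` with
`Σ_y ‖(klSrcPlainBlock V M β·S_{4M}) Y y‖·(1 + Λ_T·tnorm(x⃗_Y − x⃗_y)) ≤ C` for all time cutoffs `M` and all rows `Y`.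
[cite: BenfattoGiulianiMastropietro2006, §2.7 (2.70)–(2.71a)] -/
theorem not_exists_uniform_srcBlock_rowBound (V : ℕ) [NeZero V] {β : ℝ} (hβ : β ≠ 0) {ΛT : ℝ} (hΛT : 0 ≤ ΛT) :
    ¬ ∃ C : ℝ, ∀ (M : ℕ) [NeZero M] (Y : SpaceTimeIdx V M × SectorLeg (sectorCount 0)),
      ∑ y : GridLeg (GridPoint V (klGridN M)), ‖(klSrcPlainBlock V M β * hubbardGridSub V M β (klGridN M)) Y y‖ *
        (1 + ΛT * (Torus.tnorm (Y.1.2 - y.1.1.2) : ℝ)) ≤ C := by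
  rintro ⟨C, hC⟩
  -- a time cutoff with `log(2M+1) ≥ π·(|C| + 1)`
  set M : ℕ := ⌈Real.exp (π * (|C| + 1))⌉₊ + 1 with hM
  haveI : NeZero M := ⟨by rw [hM]; omega⟩
  have hM2 : 0 < 2 * M := by have := NeZero.ne M; omega
  have hs : 0 < sectorCount 0 := by simp [sectorCount]
  set ω : Fin (sectorCount 0) := ⟨0, hs⟩ with hω'
  have hω : (ω : ℕ) = 0 := rfl
  set x₀ : SpaceTimeIdx V M := (⟨0, hM2⟩, 0) with hx₀
  have h := hC M (x₀, ((ω, 0), 0))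
  -- weighted ≥ unweighted ≥ 1 + log(2M+1)/π
  have hunw : ∑ y : GridLeg (GridPoint V (klGridN M)), ‖(klSrcPlainBlock V M β * hubbardGridSub V M β (klGridN M)) (x₀, ((ω, 0), 0)) y‖ ≤
      ∑ y : GridLeg (GridPoint V (klGridN M)), ‖(klSrcPlainBlock V M β * hubbardGridSub V M β (klGridN M)) (x₀, ((ω, 0), 0)) y‖ *
        (1 + ΛT * (Torus.tnorm ((x₀, (((ω, (0 : Fin 2)), (0 : Fin 2)) : SectorLeg (sectorCount 0))).1.2 - y.1.1.2) : ℝ)) :=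
    Finset.sum_le_sum fun y _ => le_mul_of_one_le_right (norm_nonneg _) (by
      have : (0 : ℝ) ≤ (Torus.tnorm ((x₀, (((ω, (0 : Fin 2)), (0 : Fin 2)) : SectorLeg (sectorCount 0))).1.2 - y.1.1.2) : ℝ) := Nat.cast_nonneg _
      nlinarith)
  have hlog := srcBlock_row_ge_log hβ x₀ ω hω 0
  -- `log(2M+1) ≥ log M ≥ π(|C|+1)`
  have hMge : Real.exp (π * (|C| + 1)) ≤ (M : ℝ) := by
    have h1 := Nat.le_ceil (Real.exp (π * (|C| + 1)))
    rw [hM]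
    push_cast
    linarith
  have hM0 : (0 : ℝ) < M := Nat.cast_pos.2 (Nat.pos_of_ne_zero (NeZero.ne M))
  have hlogM : π * (|C| + 1) ≤ Real.log (2 * (M : ℝ) + 1) := by
    rw [← Real.log_exp (π * (|C| + 1))]
    exact Real.log_le_log (Real.exp_pos _) (by linarith)
  have hπ := Real.pi_pos
  have hdiv : |C| + 1 ≤ Real.log (2 * (M : ℝ) + 1) / π := by
    rw [le_div_iff₀ hπ]
    linarith
  linarith [le_abs_self C]

end Summit.HubbardSuperconductivity.HubbardSuperconductivity.Theorems.TwoVolumeSource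

end
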